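import Literature.MathematicalPhysics.QuantumFieldTheory.Balaban1983to89.B9Ineq373FirstOrderCommY
import Literature.MathematicalPhysics.QuantumFieldTheory.Balaban1983to89.B9Cor36GCubeRightEntryAtLocCfg
import Literature.MathematicalPhysics.QuantumFieldTheory.Balaban1983to89.B9Ineq386RightEntryDirs

/-!
# `Balaban1983to89.B9Cor36GVKDivForm` — COROLLARY 3.6 p. 408 FOR THE BOND-SECTOR CUBE LETTER `G_□ = Δ_{a,□}⁻¹` AT THE LOCALISED (3.35)∕(3.37) FIELD `Ṽ_□ = e^{iηχ̃_□A}`: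
# THE LEFT COMPOSITE `G_□(1)·V_□ ≺ κ_D·s·e^{−ρ_D d}` OF THE PERTURBATION WORD `V_□ = Δ_{a,□}(1) − Δ_{a,□}(Ṽ_□)` WITH `G_□(1)` ON THE LEFT — the displayed input `hDiv` of
# p33's L-ASM `B9Cor36GCubeRightEntryAtLocCfg.cor36_G_cube_rightEntry_at_locCfg` and F-F `B9Cor36GCubeLocAtMemberRight.eBlock_locLetterBY'` (right entry (3.42)₃ of
# `G_□(Ṽ_□)`), PROVED from the GRADIENT form of `V_□` at def-Y's letters and G-F8a's first-order COMMUTATORS by the lattice Leibniz rule (sub-row G-B9-LETTERS, module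
# M5.1b-G «Cor 3.5∕3.6 for the bond-sector cube letter G_□», programme RIGHT-ENTRY-V, LAYER L-DIV; lead ruling «G-F8 SPLIT» HOME/INBOX 2026-08-28T20:29:30Z; cell GAPS
# G-B9-02 entry n = 2)

T. Bałaban, *Propagators for lattice gauge theories in a background field*, Commun. Math. Phys. **99** (1985) 389–434
[`Balaban1985BackgroundPropagators`, "B9"]; [4] = Commun. Math. Phys. **96** (1984) 223–250 [`Balaban1984PropagatorsII`].

statement-level skeleton of published theorems with citation tags; proofs where landed; nothing here is a claim about the
Yang–Mills mass gap

THE PRINTED LOCUS (verbatim, held `paper:balaban1985-cmp99-background-propagators`, journal page = PDF page + 388; page owner r06).  p. 407 (3.82)–(3.86): *«V(A) =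
Δ_a(U) − Δ_a(U′U) … The operator V₃(A) is a local differential operator of the first order satisfying the bound (3.73). The operator P₁(A) was defined in (3.76). It is
a non-local bounded operator … G(U′U) = G(U) + G(U′U)V(A)G(U) (3.86). This way we get all these inequalities for the operator G(U′U)»*; p. 398 l. 20–24: *«we may
always replace ∇_U by ∇\*_U, and vice versa, in arbitrary place and combination … Using Lemma 2.1 in [4] we may replace the factor (Lʲη)^α by (Lʲη)^β(L^{j′}η)^γ»*;
p. 405 (3.73): *«|V(A; x, b)| … ≦ O(1)α₁(Lʲη)⁻²e^{−δd}, resp. O(1)α₁(Lʲη)⁻¹»* (zeroth ∕ first-order coefficients); p. 396 (3.37): *«|A′| < α₁(Lʲη)⁻¹, |∇^η_UA′| <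
α₁(Lʲη)⁻² on Ω_j»*; Cor. 3.6 p. 408 l. 7–14 (the cube road, `U = 1`, `α₁ = O(1)Mα₀`); Thm 3.3 p. 399 + (3.42) p. 397; [4] Lemma 2.1 (2.61) p. 234, (2.51)–(2.55)
p. 232, Prop. 2.6 (2.136)₃ p. 247.

WHY THIS FILE (cell `lit-balaban`; module M5.1b-G, p38 g45; cell GAPS G-B9-02).  The right entry `G_□(Ṽ_□)·∇*_ν` needs the LEFT-resolvent form of (3.86) multiplied
on the right by `∇*_ν` — `G(Ṽ)∇* = G(1)∇* + (G(1)V)·(G(Ṽ)∇*)` — whose small letter is `G(1)·V` with `G(1)` on the LEFT of `V = Z + Σ_μ W_μ∇_μ` ((3.82)–(3.85):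
zeroth-order part `Z = V⁰ + P⁰ + P₁ + (averaging piece)`, first-order coefficients `W_μ = V¹_μ + P¹_μ`).  p33's L-ASM (`cor36_G_cube_rightEntry_at_locCfg`, p667457)
and F-F (`eBlock_locLetterBY'`, p667683) display exactly this letter as `hDiv`.  The derivative `∇_μ` at the far right cannot be absorbed by a block majorant; the
lattice Leibniz rule `G(1)W_μ∇_μ = (G(1)∇_μ)·W_μ + G(1)·[W_μ, ∇_μ]` moves it onto `G(1)` (Theorem 3.3's product entry; p. 398 «we may always replace ∇_U by ∇\*_U»:
`∇_μ = −∇*_μσ_μ`, so `G(1)∇_μ = −(G(1)∇*_μ)·σ_μ` from E1 `thm33_GK_cube_right`) at the price of the commutator `[W_μ, ∇_μ]`, a zeroth-order letter of (3.37)-size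
`O(1)α₁(Lⁿη)⁻²` (G-F8a `B9Ineq373FirstOrderCommY`, p666091).  THIS FILE: §1 the gradient form IS a multi-letter divergence form (`gradForm_eq_divForm_dirs`, ring
identity) and the located letter `G·(Z + Σ_kW_k∇_k) ≺ B₀Λc₁(m·c_W + (c_Z + m·c_K))·α₁·e^{−ρd}` from p33's `hasMajorant_GV_of_divForm_dirs` (p665498); §2 the letters
`∇_μ = −∇*_μ·conj b(σ_μ)` realified and the right flat entry `G·∇_μ` from `G·∇*_μ` (one [4] (2.52)–(2.55) composition with G-F6a's shift majorant); §3 ★★★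
`cor36_GK_mul_VK_at_locCfg`: for every member above thresholds, every cover cube and every (3.35) cube datum with `s ≦ a_D`: `G_□(1)·V_□(Ṽ_□) ≺ κ_D·s·e^{−ρ_D d}` —
p33's `hDiv` VERBATIM (binders, thresholds, kernel `κ_D·sRead C Λ·e^{−ρ_D d(a,a′)}`), constants functions of `d, L, b₀, b₁, M₂`.

HOW (proof of §3, following p. 407 l. 8–17 on Cor. 3.6's cube road).  Rates: `δ = min(ρ_G, σ_E∕4, δ_P)` (G-F7's transfer rate, E1's rate at `α = ½`, G-F5c′'s rate),
`δ₁ = δ∕2` (all letters), `ρ_D = δ₂ = δ∕4`; ONE [4] (2.61) datum at `(δ₂, 9∕5000)` (p33 `exists_h261_geoCK`) and p33's inverse-power scale transfers at `δ₂` (`hST_geoCK`,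
`Λ = L⁴`).  Letters at `Ṽ_□`, rate `δ₁`: `V⁰, V¹_μ` (G-F5a + bridge II), `P⁰, P¹_μ` (G-F5b at bridge II's windows), the `P₁` word (G-F5c′ + G-F5c″, the nine readings as
in G-F7), the averaging piece (bridge II), the commutators `[V¹_μ + P¹_μ, ∇_μ]` (G-F8a); `G_□(1) ≺ A_G(Lⁿη)²e^{−δ₁d}` (G-F7 v1.1's flat entry), `G_□(1)∇_μ` (E1 + §2);
`V_□ = Z + Σ_μ W_μ∇_μ` (`VK_eq_pieces` + G-F5a + G-F5c″, re-associated); §1 ⟹ `G_□(1)V_□ ≺ κ_R·α_W(s)·e^{−δ₂d} ≦ 60κ_R·s·e^{−δ₂d}` (`α_W(s) ≦ 60s` for `s ≦ 1∕60`).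

WHAT THIS FILE PROVES (THEOREMS; 0 `def … : Prop`, 0 sorry, 0 def).  §1 `gradForm_eq_divForm_dirs`, ★ `hasMajorant_GV_of_gradForm_comm_dirs`; §2
`DK_eq_neg_DsK_mul_shift`, ★ `hasMajorant_mul_DK_of_DsK`, `add_mul_sub_mul_add`; §3 ★★★ `cor36_GK_mul_VK_at_locCfg` (= `hDiv`).

HONEST SCOPE.  Assembly over landed modules (G-F7 v1.1, E1, G-F8a, G-F5a∕b∕c′∕c″, bridge II, p33's multi-letter (3.86) calculus); DISPLAYED: the (3.35) cube datum
(`hC … hdA`, Hermitian type `hAu`), member thresholds, `s ≦ a_D`; `parS = parSymY i`, `parB = parBY i`.  NOT here: the fixed point and the right entry themselves (p33's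
L-ASM ∕ F-F take this file's theorem BY NAME), the Hölder ∕ `L²` entries.  Count-neutral; no summit ∕ sub-problem statement is proved; nothing continuum ∕ OS ∕ mass-gap ∕
Clay; NOT a node discharge; YM mass gap NOT proved by any of this (Track A conditional rung).  No `sorry`, no `axiom`, no `… : Prop` fact, no `instance`, no
`notation`.  NEW file; nothing landed is modified.  Cell `lit-balaban`, seat `lit-balaban-p38` gen 45, 2026-08-28; `--supports stmt-QuantumFields-19200`.  Net new
unproved facts: 0.

RELATED IN THE TREE, NOT DUPLICATED (searched 2026-08-28: `rg 'GV_of_divForm_dirs|rightEntry_at_locCfg|conj_cdsBₗ_one|GVKDivForm'` over `Literature/`): p33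
`B9Ineq386RightEntryDirs` (abstract multi-letter divergence form, USED), p33 `B9Cor36GCubeRightEntryAtLocCfg` ∕ `B9Cor36GCubeLocAtMemberRight` (the consumers;
`conj_cdsBₗ_one` USED), r06 `B9Ineq386RightEntry` §5 (one direction, abstract), E1 `B9Thm33CubeAtOneRight` (USED), G-F7 `B9Cor36GCubeAtLocCfg` (slot derivations
copied by name), G-F8a (USED), G-F6a `B9Cor36GCubeEntriesAtV` (shift letters, USED), G-F5′ `ineq385_op_dirs` (the mirror image with `G` on the right).
-/

noncomputable section

namespace Literature.MathematicalPhysics.QuantumFieldTheory.Balaban1983to89.B9Cor36GVKDivForm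

open NormedSpace Complex
open B4PartitionUnity22 (thetaProf D1)
open B6RandomWalk (HasMajorant hasMajorant_mono hasMajorant_add hasMajorant_mul Triangle254 Ineq261 c1_nonneg delta3 delta3_pos)
open B9Thm34Ext (toB6)
open B9Ineq347 (ScaleTransfer)
open B9Eq352DivFormLetters (conj)
open B9Eq39Adjoint (fluct covD covDstar)
open B6KLevelCensusIndexV1 (KIdx kGeo)
open B6Cover236MultiLevelBlocks (cubes)
open B6GlobalChartV1 (PV boxEquiv)
open B9BackgroundsKLevelV1 (shiftsV1)
open B9Eq360DeltaPrimeAY (AfldY chartA)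
open B9Eq360DeltaPrimeACubeY (blkCubeY kFCubeY sFCubeY levCubeY_eq)
open B9CubeLettersOpsL0 (cubeFamY levCubeY GpCubeY)
open B9CubeLettersBondOpsL0 (BlkCubeY qpKc qpsKc QpCubeY QpsCubeY XinvCubeY deltaACubeY)
open B9CubeGeometryInputs (geoCK geoCK_len geoCK_eta geoCK_eta_pos geoCK_len_pos geoCK_len_blkCubeY geoCK_dist_axioms RM1 N1 exists_h261_geoCK hST_geoCK)
open B9Cor36CutoffField337 (cutFldY)
open B9Cor36CubeCutoffs (SC NearC chiTY locCfgY readings337_locFld scaleLen_levCubeY_bounds)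
open B9Eq359CubeKernelsAtOne (Cq Cq_nonneg norm_kFCubeY_parSymY_le norm_sFCubeY_parSymY_le ownLevel_of_blockwise)
open B9Eq357CubeLetters (norm_QpCubeY_prod_sub_apply_le norm_QpsCubeY_prod_sub_apply_le)
open B9Cor35GpCubeInputsAtOne (wK hasMajorant_neg)
open B9Cor35GCubeInputsAtOne (blkBK GK DK LapK GVK VK)
open B9Cor35GAtCubeLetters (lapPieceK projPieceK hasMajorant_fsum VK_eq_pieces)
open B9Cor35CinvAtCubeLetters (kernel_rate_mono)
open B9Eq371CoCurlLeibnizY (V0Y V1Y conj_hessY_one_sub_hessY_eq)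
open B9Eq375GradDivSplitY (P0Y P1Y)
open B9Ineq373HessianPieceBoundsY (cV0 cV1)
open B9Ineq375GradDivBoundsY (cP0 cP1 hasMajorant_P0Y hasMajorant_P1Y)
open B9Cor36GCubeWindows (sRead sRead_nonneg alphaW alphaW_nonneg unitaryLike_locCfgY hW1_locCfgY hW2_locCfgY hasMajorant_V0Y_locCfgY hasMajorant_V1Y_locCfgY
  hasMajorant_avgPieceK_locCfgY)
open B9Cor35GCubeAvgPiece (avgPieceK kappaAv)
open B9Cor35POneAtCubeLetters (cor35_POne_cube)
open B9Eq376ProjPieceDictY (hasMajorant_projWord_of_POne projPieceK_eq_firstOrder_add_projWord)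
open B9Cor36GCubeAtLocCfg (self_le_alphaW alphaW_le_sixty_mul kappaAv_le_of_le_one kernel_const_mono cor36_G_cube_at_locCfg')
open B9Ineq366CPrime (hasMajorant_comp_decay_right1 hasMajorant_rate_mono)
open B9Ineq386RightEntryDirs (hasMajorant_GV_of_divForm_dirs)
open B9Thm33CubeAtOneRight (DsK thm33_GK_cube_right)
open B9Cor36GCubeRightEntryAtLocCfg (conj_cdsBₗ_one)
open B9Cor36GCubeEntriesAtV (shiftOpB cdsBₗ_one_mul_shiftOpB conj_cdBₗ_one hasMajorant_conj_shiftOpB)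
open B9CoReadingCoords (cdBₗ cdsBₗ)
open B9Ineq373FirstOrderCommY (cK1 hasMajorant_commV1Y_locCfgY hasMajorant_commP1Y_locCfgY)
open Node00 (SiteY CfgY FBondY SiteParY toKT shiftY parSymY parSymY_one parBY parBY_one)

variable {d ℓ : ℕ} {hd : 1 ≤ d + 1} {hL : Odd (ℓ + 1) ∧ 1 < ℓ + 1} {b₀ b₁ : ℝ}

/-! ## §1  The gradient form `Z + Σ_k W_k∇_k` IS a multi-letter divergence form; the located letter `G·V` with `G` on the LEFT (any geometry) -/

section Abstract

variable {g : B9.Geometry} [Fintype g.Site] {R : ℝ} {H : Prop} {W : Type}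

/-- **Lattice Leibniz rule, letter form**: `Z + Σ_k W_k∇_k = Σ_k ∇_kW_k + (Z + Σ_k(W_k∇_k − ∇_kW_k))` (ring identity; the content is in the sizes of the commutators —
the (3.37) size of the coefficient differences — and in Theorem 3.3's entry for the product `G∇_k`).
[cite: Balaban1985BackgroundPropagators, (3.82)–(3.85) p.407, (3.73) p.405, (3.37) p.396, p.398 l.20–24; Balaban1984PropagatorsII, (2.52) p.232] -/
theorem gradForm_eq_divForm_dirs {κ : Type} [Fintype κ] (Z : Module.End ℝ (W → ℝ)) (W₁ D : κ → Module.End ℝ (W → ℝ)) :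
    Z + ∑ k, W₁ k * D k = ∑ k, D k * W₁ k + (Z + ∑ k, (W₁ k * D k - D k * W₁ k)) := by
  rw [add_left_comm, ← Finset.sum_add_distrib]
  congr 1
  refine Finset.sum_congr rfl fun k _ => ?_
  abel

/-- ★ **`G·(Z + Σ_kW_k∇_k) ≺ B₀Λc₁(δ₀,β)·(m·c_W + (c_Z + m·c_K))·α₁·e^{−ρd}` from the GRADIENT form with `m = |κ|` directions and the commutator letters** — p33's
`hasMajorant_GV_of_divForm_dirs` ([4] (2.52)–(2.55) word by word, `G` on the LEFT) at the divergence form of `gradForm_eq_divForm_dirs`: inputs `Z ≺ c_Zα₁(Lⁿη)⁻²e^{−δd}`,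
`W_k ≺ c_Wα₁(Lⁿη)⁻¹e^{−δd}`, `W_k∇_k − ∇_kW_k ≺ c_Kα₁(Lⁿη)⁻²e^{−δd}`, `G ≺ B₀(Lⁿη)²e^{−δd}`, `G∇_k ≺ B₀Lⁿη·e^{−δd}` (Theorem 3.3's product entry, p. 398 «we may always
replace ∇_U by ∇\*_U»), [4] (2.61) at `(δ₀, β)`, the two inverse-power scale transfers at `(δ₀, α)`, `ρ + (α + β)δ₀ ≦ δ`.
[cite: Balaban1985BackgroundPropagators, (3.82)–(3.86) p.407, (3.73) p.405, (3.37) p.396, Thm 3.3 p.399, (3.42) p.397, p.398 l.20–24; Balaban1984PropagatorsII, Lemma 2.1 (2.61) p.234, (2.51)–(2.55) p.232] -/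
theorem hasMajorant_GV_of_gradForm_comm_dirs {κ : Type} [Fintype κ] (blk : W → g.Site) (d : ℕ) (δ₀ δ α β ρ Λ B₀ cZ cW cK α₁ : ℝ)
    (hB₀ : 0 ≤ B₀) (hcZ : 0 ≤ cZ) (hcW : 0 ≤ cW) (hcK : 0 ≤ cK) (hα₁ : 0 ≤ α₁) (hΛ : 0 ≤ Λ) (hρ : 0 ≤ ρ)
    (hα : 0 ≤ α) (hβ : 0 ≤ β) (hδ₀ : 0 ≤ δ₀) (hr : ρ + (α + β) * δ₀ ≤ δ)
    (hdnn : ∀ a b : g.Site, 0 ≤ g.dist a b) (htri : Triangle254 (toB6 g R H)) (hlen : ∀ y : g.Site, 0 < g.len y)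
    (h261 : Ineq261 d (toB6 g R H) δ₀ β)
    (hT1i : ScaleTransfer g δ₀ α Λ (fun a => (g.len a)⁻¹)) (hT2i : ScaleTransfer g δ₀ α Λ (fun a => (g.len a ^ 2)⁻¹))
    {G Z : Module.End ℝ (W → ℝ)} {W₁ D : κ → Module.End ℝ (W → ℝ)}
    (hZ : HasMajorant (g := toB6 g R H) blk Z (fun a b => cZ * α₁ * (g.len a ^ 2)⁻¹ * Real.exp (-(δ * g.dist a b))))
    (hW : ∀ k, HasMajorant (g := toB6 g R H) blk (W₁ k) (fun a b => cW * α₁ * (g.len a)⁻¹ * Real.exp (-(δ * g.dist a b))))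
    (hCm : ∀ k, HasMajorant (g := toB6 g R H) blk (W₁ k * D k - D k * W₁ k)
      (fun a b => cK * α₁ * (g.len a ^ 2)⁻¹ * Real.exp (-(δ * g.dist a b))))
    (hG : HasMajorant (g := toB6 g R H) blk G (fun a b => B₀ * g.len a ^ 2 * Real.exp (-(δ * g.dist a b))))
    (hGD : ∀ k, HasMajorant (g := toB6 g R H) blk (G * D k) (fun a b => B₀ * g.len a * Real.exp (-(δ * g.dist a b)))) :
    HasMajorant (g := toB6 g R H) blk (G * (Z + ∑ k, W₁ k * D k))
      (fun a b => (B₀ * Λ * B6.c1 d δ₀ β * ((Fintype.card κ : ℝ) * cW + (cZ + Fintype.card κ * cK))) * α₁ * Real.exp (-(ρ * g.dist a b))) := by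
  -- the zeroth-order letter of the divergence form: `C = Z + Σ_k [W_k, ∇_k]`
  have hS := hasMajorant_fsum (R := R) (H := H) blk Finset.univ (fun k => W₁ k * D k - D k * W₁ k) _ (fun k _ => hCm k)
  have hC : HasMajorant (g := toB6 g R H) blk (Z + ∑ k, (W₁ k * D k - D k * W₁ k))
      (fun a b => (cZ + Fintype.card κ * cK) * α₁ * (g.len a ^ 2)⁻¹ * Real.exp (-(δ * g.dist a b))) := by
    refine hasMajorant_mono (g := toB6 g R H) blk (hasMajorant_add (g := toB6 g R H) blk hZ hS) fun a b => le_of_eq ?_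
    simp only [Finset.sum_const, Finset.card_univ, nsmul_eq_mul]
    ring
  exact hasMajorant_GV_of_divForm_dirs (R := R) (H := H) blk d δ₀ δ α β ρ Λ B₀ cW (cZ + Fintype.card κ * cK) α₁ hB₀ hcW (by positivity) hα₁ hΛ hρ hα hβ hδ₀ hr
    hdnn htri hlen h261 hT1i hT2i (gradForm_eq_divForm_dirs Z W₁ D) hW hC hG hGD

end Abstract

/-! ## §2  The letters at the cube: `∇_μ = −∇*_μσ_μ` realified, and the right flat entry `G·∇_μ` from `G·∇*_μ` -/

section Cube

variable {𝔸 : Type} [NormedRing 𝔸] [NormedAlgebra ℂ 𝔸] [CompleteSpace 𝔸]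
variable {ι : Type} [Fintype ι] (b : Module.Basis ι ℝ 𝔸)
variable (i : KIdx d ℓ hd hL b₀ b₁) (c : ↥(cubes (toKT i).D.toDomains))

/-- `∇_{1,μ} = −∇*_{1,μ}σ_μ`, realified: `DK μ = −(DsK μ · conj b(σ_μ))` (`c_f(X(x+e_μ) − X(x)) = −c_f(X(x+e_μ−e_μ) − X(x+e_μ))`; G-F6a's `cdsBₗ_one_mul_shiftOpB`, p33's
`conj_cdsBₗ_one`). [cite: Balaban1985BackgroundPropagators, (3.3) p.390, (3.8) p.392, p.398 l.20–24 («we may always replace ∇_U by ∇\*_U»), bookkeeping] -/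
theorem DK_eq_neg_DsK_mul_shift (μ : Fin (d + 1)) :
    DK b i μ = -(DsK b i μ * conj b ((shiftOpB (𝔸 := 𝔸) i μ).restrictScalars ℝ)) := by
  rw [← conj_cdsBₗ_one, ← B9Eq352DivFormLetters.conj_mul, cdsBₗ_one_mul_shiftOpB, B9Eq352DivFormLetters.conj_neg, conj_cdBₗ_one, neg_neg]

/-- ★ **the RIGHT flat entry `G·∇_μ` from `G·∇*_μ`** (p. 398 «we may always replace ∇_U by ∇\*_U»): `G·∇*_μ ≺ A·Lⁿη·e^{−rd}` and `conj b(σ_μ) ≺ e^{ρ}e^{−ρd}` (one lattice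
step, G-F6a) give, by [4] (2.52)–(2.55) with the (2.61) datum at `(δ₀, β)` and `ρ + 2βδ₀ ≦ r`, `G·∇_μ = −(G·∇*_μ)·σ_μ ≺ A·e^{ρ}·c₁(δ₀,β)·Lⁿη·e^{−ρd}`.
[cite: Balaban1985BackgroundPropagators, p.398 l.20–24, (3.42) p.397, (3.3)∕(3.8) pp.390–392; Balaban1984PropagatorsII, (2.52)–(2.55) p.232, Lemma 2.1 (2.61) p.234] -/
theorem hasMajorant_mul_DK_of_DsK (Rr : ℝ) (H : Prop) (dB : ℕ) {δ₀ β ρ r A : ℝ} (hA : 0 ≤ A) (hρ : 0 ≤ ρ) (hβδ : 0 ≤ β * δ₀)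
    (hr : ρ + (β + β) * δ₀ ≤ r) (h261 : Ineq261 dB (toB6 (geoCK i c) Rr H) δ₀ β) {G : Module.End ℝ (FBondY i × ι → ℝ)} (μ : Fin (d + 1))
    (h : HasMajorant (g := toB6 (geoCK i c) Rr H) (blkBK i c) (G * DsK b i μ)
      (fun a a' => A * (geoCK i c).len a * Real.exp (-(r * (geoCK i c).dist a a')))) :
    HasMajorant (g := toB6 (geoCK i c) Rr H) (blkBK i c) (G * DK b i μ)
      (fun a a' => A * Real.exp ρ * B6.c1 dB δ₀ β * (geoCK i c).len a * Real.exp (-(ρ * (geoCK i c).dist a a'))) := by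
  obtain ⟨hdnn, htri, -, -⟩ := geoCK_dist_axioms i c Rr H
  have hS := hasMajorant_conj_shiftOpB i c b Rr H hρ μ
  have key := hasMajorant_comp_decay_right1 (R := Rr) (H := H) (blkBK i c) dB δ₀ β β ρ r A (Real.exp ρ) (fun a => (geoCK i c).len a)
    (fun a => (geoCK_len_pos i c a).le) hA (Real.exp_pos _).le hρ hβδ hr hdnn htri h261 h hS
  have e : G * DK b i μ = -(G * DsK b i μ * conj b ((shiftOpB (𝔸 := 𝔸) i μ).restrictScalars ℝ)) := by
    rw [DK_eq_neg_DsK_mul_shift, mul_assoc]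
    exact mul_neg G (DsK b i μ * conj b ((shiftOpB (𝔸 := 𝔸) i μ).restrictScalars ℝ))
  rw [e]
  exact hasMajorant_neg (g := toB6 (geoCK i c) Rr H) (blkBK i c) key

omit [CompleteSpace 𝔸] [Fintype ι] in
/-- `(A + B)·D − D·(A + B) = (A·D − D·A) + (B·D − D·B)` (the commutator is additive). [cite: Balaban1984PropagatorsII, (2.52) p.232, bookkeeping] -/
theorem add_mul_sub_mul_add (A B D : Module.End ℝ (FBondY i × ι → ℝ)) : (A + B) * D - D * (A + B) = (A * D - D * A) + (B * D - D * B) := by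
  rw [add_mul, mul_add]
  abel

end Cube

/-! ## §3 ★★★ The left composite `G_□(1)·V_□(Ṽ_□) ≺ κ_D·s·e^{−ρ_D d}` — p33's `hDiv`, every input plugged from the (3.35) datum -/

section Main

variable {𝔸 : Type} [NormedRing 𝔸] [NormedAlgebra ℂ 𝔸] [CompleteSpace 𝔸]
variable {ι : Type} [Fintype ι] (b : Module.Basis ι ℝ 𝔸)

set_option maxHeartbeats 4000000 in
/-- ★★★ **COROLLARY 3.6'S SMALL LETTER FOR THE RIGHT ENTRY OF THE BOND-SECTOR CUBE LETTER: `G_□(1)·V_□(Ṽ_□) ≺ κ_D·s·e^{−ρ_D·d}` AT THE LOCALISED FIELD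
`Ṽ_□ = e^{iηχ̃_□A}`, UNIFORMLY IN THE MEMBER AND THE COVER CUBE** (`V_□(Ṽ) = Δ_{a,□}(1) − Δ_{a,□}(Ṽ)` realified = `VK`, `G_□(1)` realified = `GK`; p33's displayed
`hDiv` of `cor36_G_cube_rightEntry_at_locCfg` ∕ `eBlock_locLetterBY'` VERBATIM): there are a rate `ρ_D > 0`, a constant `κ_D ≧ 0`, member thresholds `M_D, T_D, N_D` and a
size threshold `a_D > 0` — functions of `d, L, b₀, b₁` and the basis datum `M₂` only — such that for every member above the thresholds, every cover cube `□`, every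
`Rr, H` and every vector potential `A` of Hermitian type carrying the (3.35) cube datum `(Q, C, ξ, Λ)` with `s = max(C, C(1+D₁θ))Λ² ≦ a_D`:
`GK·VK(Ṽ_□) ≺ κ_D·s·e^{−ρ_D·d(a,a′)}` over `(toB6 (geoCK i □) Rr H, blkBK i □)` (transporters `parSymY`, `parBY`).
[cite: Balaban1985BackgroundPropagators, Cor. 3.6 p.408, (3.82)–(3.86) p.407, (3.69)–(3.77) pp.404–406, (3.73) p.405, (3.37) p.396, Thm 3.3 p.399, (3.42) p.397, p.398 l.20–24, Cor. 3.5 p.407, p.409 l.1–5; Balaban1984PropagatorsII, Lemma 2.1 (2.61) p.234, (2.51)–(2.55) p.232, Prop. 2.6 (2.136)₃ p.247] -/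
theorem cor36_GK_mul_VK_at_locCfg [NormOneClass 𝔸] [DecidableEq ι] (hℓ : 1 ≤ ℓ) (hb₀ : 0 < b₀) (hb₁ : b₀ ≤ b₁) (M₂ : ℝ) (hM₂ : 0 ≤ M₂)
    (hrepr : ∀ (v : 𝔸) (j : ι), |b.repr v j| ≤ M₂ * ‖v‖) :
    ∃ ρD κD MD TD : ℝ, ∃ ND : ℕ, 0 < ρD ∧ 0 ≤ κD ∧ ∃ aD : ℝ, 0 < aD ∧
    ∀ (i : KIdx d ℓ hd hL b₀ b₁) (c : ↥(cubes (toKT i).D.toDomains)) (Rr : ℝ) (H : Prop),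
      MD ≤ ((ℓ : ℝ) + 1) * (toKT i).Mh → ND + 1 ≤ (toKT i).R * ((ℓ + 1) * (toKT i).Mh) → TD ≤ RM1 i →
    ∀ (A : AfldY 𝔸 i) (Q : Set (Site (PV d ℓ i.m i.K hd hL) 0)) (C ξ Λ : ℝ),
      0 ≤ C → 0 < ξ → 1 ≤ Λ → ξ ≤ 5 * (SC i c : ℝ) * (kGeo i).eta → LatticeNorms.scaleLen ((ℓ : ℝ) + 1) (kGeo i).eta (c.1.1 + 1) ≤ Λ * ξ →
      (∀ x : Site (PV d ℓ i.m i.K hd hL) 0, NearC i c (35 * SC i c / 8 + 1) (boxEquiv i.hN x).1 → x ∈ Q) →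
      (∀ κ, ∀ x ∈ Q, ‖A κ x‖ ≤ C * ξ⁻¹) →
      (∀ μ ν, ∀ x ∈ Q, ‖(((kGeo i).eta : ℂ)⁻¹) • covD (shiftsV1 (PV d ℓ i.m i.K hd hL)) (fun _ _ => (1 : 𝔸ˣ)) μ (A ν) x‖ ≤ C * (ξ ^ 2)⁻¹) →
      (∀ (t : ℝ) (κ : Fin (d + 1)) (x : Site (PV d ℓ i.m i.K hd hL) 0), ‖NormedSpace.exp ((I * (t : ℂ)) • A κ x)‖ ≤ 1) →
      sRead C Λ ≤ aD →
      HasMajorant (g := toB6 (geoCK i c) Rr H) (blkBK i c)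
        (GK b i c (parSymY i) (parBY i) * VK b i c (parSymY i) (parBY i) (locCfgY i c (kGeo i).eta A))
        (fun a a' => κD * sRead C Λ * Real.exp (-(ρD * (geoCK i c).dist a a'))) := by
  classical
  have h1A : ‖(1 : 𝔸)‖ ≤ 1 := norm_one.le
  have hSb : 0 ≤ ∑ j, ‖b j‖ := Finset.sum_nonneg fun j _ => norm_nonneg _
  have hMS : 0 ≤ M₂ * ∑ j, ‖b j‖ := mul_nonneg hM₂ hSb
  have hL1 : (1 : ℝ) ≤ (ℓ : ℝ) + 1 := by linarith [(Nat.cast_nonneg ℓ : (0 : ℝ) ≤ ℓ)]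
  have hb₁0 : 0 ≤ b₁ := hb₀.le.trans hb₁
  -- E1: Theorem 3.3's right entry for `G_□(1)` at `(σ_E, α = ½)`, rate `σ_E∕4`
  obtain ⟨σE, hσE, hE⟩ := thm33_GK_cube_right (d := d) (ℓ := ℓ) (hd := hd) (hL := hL) (𝔸 := 𝔸) b hb₀ hb₁
  obtain ⟨AE, ME, hAE, hME, hE'⟩ := hE σE hσE le_rfl (1 / 2) (by norm_num) (by norm_num)
  have hrE : 0 < (1 - 1 / 2) * σE / 2 := by positivity
  -- G-F7 v1.1: the unit, the (3.86) laws and the flat entry of `G_□(1)` at the rate `ρ_G`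
  obtain ⟨ρ₇, θ₇, M₇, T₇, N₇, hρ₇, -, a₇, ha₇, AG, hAG, h7⟩ := cor36_G_cube_at_locCfg' b hℓ hb₀ hb₁ M₂ hM₂ hrepr
  -- G-F5c′: (3.77) for the `P₁` word at the cube
  obtain ⟨δP, MP, TP, NP, hδP, aP, haP, K, hK, hP⟩ := cor35_POne_cube b d ℓ hℓ (Cq d) M₂ (Cq_nonneg d) hM₂ hrepr h1A
  -- one rate below the three, and its halves
  set δ : ℝ := min ρ₇ (min ((1 - 1 / 2) * σE / 2) δP) with hδdef
  have hδ : 0 < δ := lt_min hρ₇ (lt_min hrE hδP)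
  have hδ₇ : δ ≤ ρ₇ := min_le_left _ _
  have hδE : δ ≤ (1 - 1 / 2) * σE / 2 := (min_le_right _ _).trans (min_le_left _ _)
  have hδP' : δ ≤ δP := (min_le_right _ _).trans (min_le_right _ _)
  set δ₁ : ℝ := δ / 2 with hδ₁def
  set δ₂ : ℝ := δ / 4 with hδ₂def
  have hδ₁ : 0 < δ₁ := by positivity
  have hδ₂ : 0 < δ₂ := by positivity
  have hδ₁δ : δ₁ ≤ δ := by rw [hδ₁def]; linarith only [hδ.le]
  -- (2.61) at `(δ₂, 9∕5000)` (p33 5a)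
  obtain ⟨dB, h261⟩ := exists_h261_geoCK d ℓ hδ₂
  have hc1 : 0 ≤ B6.c1 dB δ₂ (9 / 5000) := c1_nonneg _ _ _
  -- the constants
  set Λ4 : ℝ := ((ℓ : ℝ) + 1) ^ 4 with hΛ4def
  have hΛ4 : 0 ≤ Λ4 := by positivity
  set cV : ℝ := (M₂ * ∑ j, ‖b j‖) * max (cV0 d) (cV1 d) * Real.exp (2 * δ₁) with hcVdef
  set cP : ℝ := (M₂ * ∑ j, ‖b j‖) * max (cP0 d) (cP1 d) * Real.exp (2 * δ₁) with hcPdef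
  set κ₂ : ℝ := (M₂ * ∑ j, ‖b j‖) * (8 * ((d : ℝ) + 2) * (1 + ((d : ℝ) + 2)) * b₁ * (((ℓ + 1 : ℕ) : ℝ) ^ (d + 1)) * Real.exp (δ₁ * (2 * (ℓ : ℝ) + 6)))
    with hκ₂def
  set cKc : ℝ := (M₂ * ∑ j, ‖b j‖) * ((cK1 d + cP1 d) * Real.exp (3 * δ₁)) with hcKcdef
  have hcV00 : 0 ≤ cV0 d := by unfold cV0; positivity
  have hcP00 : 0 ≤ cP0 d := by unfold cP0; positivity
  have hcK10 : 0 ≤ cK1 d := by unfold cK1; positivity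
  have hcP10 : 0 ≤ cP1 d := by unfold cP1; positivity
  have hcV : 0 ≤ cV := by rw [hcVdef]; exact mul_nonneg (mul_nonneg hMS (le_max_of_le_left hcV00)) (Real.exp_pos _).le
  have hcP : 0 ≤ cP := by rw [hcPdef]; exact mul_nonneg (mul_nonneg hMS (le_max_of_le_left hcP00)) (Real.exp_pos _).le
  have hκ₂ : 0 ≤ κ₂ := by rw [hκ₂def]; positivity
  have hcKc : 0 ≤ cKc := by rw [hcKcdef]; positivity
  set B₀ : ℝ := AG + AE * Real.exp δ₁ * B6.c1 dB δ₂ (9 / 5000) with hB₀def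
  have hB₀ : 0 ≤ B₀ := by rw [hB₀def]; positivity
  have hAGB : AG ≤ B₀ := by rw [hB₀def]; exact le_add_of_nonneg_right (by positivity)
  have hAEB : AE * Real.exp δ₁ * B6.c1 dB δ₂ (9 / 5000) ≤ B₀ := by rw [hB₀def]; exact le_add_of_nonneg_left hAG
  set cZ : ℝ := cV + cP + K + κ₂ with hcZdef
  have hcZ : 0 ≤ cZ := by rw [hcZdef]; positivity
  set κR : ℝ := B₀ * Λ4 * B6.c1 dB δ₂ (9 / 5000) * (cZ + ((d : ℝ) + 1) * ((cV + cP) + cKc)) with hκRdef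
  have hκR : 0 ≤ κR := by rw [hκRdef]; positivity
  -- the size threshold and the output constant
  set aD : ℝ := min a₇ (min aP (1 / 60)) with haDdef
  have haD : 0 < aD := lt_min ha₇ (lt_min haP (by norm_num))
  refine ⟨δ₂, 60 * κR, max M₇ (max MP ME), max T₇ (max TP (4 * Real.log ((ℓ : ℝ) + 1) / (9 / 5000 * δ₂))),
    max N₇ (max NP (N1 d ℓ (9 / 5000 * δ₂))), hδ₂, by positivity, aD, haD, ?_⟩
  intro i c Rr H hM hN hT A Q C ξ Λ hC hξ hΛ hξS hΛξ hQ hA hdA hAu hsa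
  -- thresholds
  have hM7 : M₇ ≤ ((ℓ : ℝ) + 1) * (toKT i).Mh := (le_max_left _ _).trans hM
  have hMP : MP ≤ ((ℓ : ℝ) + 1) * (toKT i).Mh := ((le_max_left _ _).trans (le_max_right _ _)).trans hM
  have hME' : ME ≤ ((ℓ : ℝ) + 1) * i.Mh := ((le_max_right _ _).trans (le_max_right _ _)).trans hM
  have hN7 : N₇ + 1 ≤ (toKT i).R * ((ℓ + 1) * (toKT i).Mh) := le_trans (Nat.succ_le_succ (le_max_left _ _)) hN
  have hNP : NP + 1 ≤ (toKT i).R * ((ℓ + 1) * (toKT i).Mh) := le_trans (Nat.succ_le_succ ((le_max_left _ _).trans (le_max_right _ _))) hN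
  have hN1 : N1 d ℓ (9 / 5000 * δ₂) + 1 ≤ (toKT i).R * ((ℓ + 1) * (toKT i).Mh) :=
    le_trans (Nat.succ_le_succ ((le_max_right _ _).trans (le_max_right _ _))) hN
  have hT7 : T₇ ≤ RM1 i := (le_max_left _ _).trans hT
  have hTP : TP ≤ RM1 i := ((le_max_left _ _).trans (le_max_right _ _)).trans hT
  have hT2 : 4 * Real.log ((ℓ : ℝ) + 1) / (9 / 5000 * δ₂) ≤ RM1 i := ((le_max_right _ _).trans (le_max_right _ _)).trans hT
  -- the size `s` and the window size `α_W(s)`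
  set s : ℝ := sRead C Λ with hsdef
  have hs0 : 0 ≤ s := sRead_nonneg hC Λ
  have hs7 : s ≤ a₇ := hsa.trans (min_le_left _ _)
  have hsP : s ≤ aP := hsa.trans ((min_le_right _ _).trans (min_le_left _ _))
  have hs60 : s ≤ 1 / 60 := hsa.trans ((min_le_right _ _).trans (min_le_right _ _))
  have hs6 : s ≤ 1 / 6 := by linarith only [hs60]
  have hs4 : max C (C * (1 + D1 thetaProf)) * Λ ^ 2 ≤ 1 / 4 := by show s ≤ 1 / 4; linarith only [hs60]
  set αW : ℝ := alphaW s with hαWdef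
  have hαW0 : 0 ≤ αW := alphaW_nonneg hs0
  have hαW60 : αW ≤ 60 * s := alphaW_le_sixty_mul hs0 hs6
  have hαW1 : αW ≤ 1 := by linarith only [hαW60, hs60]
  -- geometry
  haveI : Nonempty (geoCK i c).Site := B9CubeGeometryInputs.geoCK_site_nonempty i c
  obtain ⟨hdnn, htri, -, -⟩ := geoCK_dist_axioms i c Rr H
  set η : ℝ := (kGeo i).eta with hηdef
  have hη : 0 < η := by rw [hηdef, ← geoCK_eta i c]; exact geoCK_eta_pos i c
  have hparS : ∀ z w : SiteY i, parSymY i (fun _ _ => (1 : 𝔸ˣ)) z w = 1 := fun z w => parSymY_one i z w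
  have hparB : ∀ s s', parBY (𝔸 := 𝔸) i (fun _ _ => 1) s s' = 1 := fun s s' => parBY_one i s s'
  have hU := unitaryLike_locCfgY i c hAu (kGeo i).eta
  have hlen0 : ∀ y : BlkCubeY i c, 0 ≤ (geoCK i c).len y := fun y => (geoCK_len_pos i c y).le
  -- (2.61) at `(δ₂, 9∕5000)` and the two inverse-power scale transfers
  have h261' : Ineq261 dB (toB6 (geoCK i c) Rr H) δ₂ (9 / 5000) := h261 i c Rr H hN1 (9 / 5000) le_rfl (by norm_num)
  obtain ⟨-, -, hST3, hST4, -, -⟩ := hST_geoCK i c hδ₂ hT2 (9 / 5000) le_rfl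
  -- G-F7 v1.1 at the datum: the flat entry of `G_□(1)` (rate `ρ_G ≥ δ₁`, constant weakened to `B₀`)
  obtain ⟨-, -, -, ⟨gG, -, -⟩, -⟩ := h7 i c Rr H hM7 hN7 hT7 A Q C ξ Λ hC hξ hΛ hξS hΛξ hQ hA hdA hAu hs7
  have hGδ₁ : HasMajorant (g := toB6 (geoCK i c) Rr H) (blkBK i c) (GK b i c (parSymY i) (parBY i))
      (fun a a' => B₀ * (geoCK i c).len a ^ 2 * Real.exp (-(δ₁ * (geoCK i c).dist a a'))) :=
    hasMajorant_mono (g := toB6 (geoCK i c) Rr H) _ gG fun a a' => kernel_const_mono hdnn (fun a => (geoCK i c).len a ^ 2) (fun _ => sq_nonneg _) hAGB hB₀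
      (hδ₁δ.trans hδ₇) a a'
  -- E1 at the member: `G_□(1)∇*_μ`, rate weakened `σ_E∕4 → δ`
  have gE := hE' i c Rr H (parSymY i) (parBY i) hparS hparB hME'
  have hGDsδ : ∀ μ, HasMajorant (g := toB6 (geoCK i c) Rr H) (blkBK i c) (GK b i c (parSymY i) (parBY i) * DsK b i μ)
      (fun a a' => AE * (geoCK i c).len a * Real.exp (-(δ * (geoCK i c).dist a a'))) := fun μ =>
    hasMajorant_rate_mono (R := Rr) (H := H) (blkBK i c) AE (fun a => (geoCK i c).len a) hAE hlen0 hδE hdnn (gE μ)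
  -- §2: the right flat entry `G_□(1)∇_μ` at the rate `δ₁`, constant weakened to `B₀`
  have hGDδ₁ : ∀ μ, HasMajorant (g := toB6 (geoCK i c) Rr H) (blkBK i c) (GK b i c (parSymY i) (parBY i) * DK b i μ)
      (fun a a' => B₀ * (geoCK i c).len a * Real.exp (-(δ₁ * (geoCK i c).dist a a'))) := fun μ => by
    have h := hasMajorant_mul_DK_of_DsK b i c Rr H dB (δ₀ := δ₂) (β := 9 / 5000) (ρ := δ₁) (r := δ) hAE hδ₁.le (by positivity)
      (by rw [hδ₁def, hδ₂def]; linarith only [hδ.le]) h261' μ (hGDsδ μ)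
    exact hasMajorant_mono (g := toB6 (geoCK i c) Rr H) _ h fun a a' =>
      kernel_const_mono hdnn (fun a => (geoCK i c).len a) hlen0 hAEB hB₀ le_rfl a a'
  -- SLOT `V⁰`, `V¹_μ`: G-F5a + bridge II at the rate `δ₁`
  have hLap : lapPieceK b i (locCfgY i c (kGeo i).eta A) =
      conj b ((V0Y i (locCfgY i c (kGeo i).eta A)).restrictScalars ℝ) + ∑ μ, conj b ((V1Y i (locCfgY i c (kGeo i).eta A) μ).restrictScalars ℝ) * DK b i μ :=
    conj_hessY_one_sub_hessY_eq i b _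
  have hV0 := hasMajorant_V0Y_locCfgY b i c hC hξ hΛ hξS hΛξ hQ hA hdA hAu hM₂ hrepr hαW1 hδ₁.le Rr H
  have hV1 := hasMajorant_V1Y_locCfgY b i c hC hξ hΛ hξS hΛξ hQ hA hdA hAu hM₂ hrepr hδ₁.le Rr H
  have hV0' : HasMajorant (g := toB6 (geoCK i c) Rr H) (blkBK i c) (conj b ((V0Y i (locCfgY i c (kGeo i).eta A)).restrictScalars ℝ))
      (fun a a' => cV * αW * ((geoCK i c).len a ^ 2)⁻¹ * Real.exp (-(δ₁ * (geoCK i c).dist a a'))) := by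
    refine hasMajorant_mono (g := toB6 (geoCK i c) Rr H) _ hV0 fun a a' => ?_
    have hw : 0 ≤ αW * ((geoCK i c).len a ^ 2)⁻¹ * Real.exp (-(δ₁ * (geoCK i c).dist a a')) := by positivity
    have hle : (M₂ * ∑ j, ‖b j‖) * (cV0 d * Real.exp (2 * δ₁)) ≤ cV := by
      rw [hcVdef, mul_assoc (M₂ * ∑ j, ‖b j‖)]; exact mul_le_mul_of_nonneg_left (mul_le_mul_of_nonneg_right (le_max_left _ _) (Real.exp_pos _).le) hMS
    calc (M₂ * ∑ j, ‖b j‖) * (cV0 d * Real.exp (2 * δ₁) * αW * ((geoCK i c).len a ^ 2)⁻¹ * Real.exp (-(δ₁ * (geoCK i c).dist a a')))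
        = (M₂ * ∑ j, ‖b j‖) * (cV0 d * Real.exp (2 * δ₁)) * (αW * ((geoCK i c).len a ^ 2)⁻¹ * Real.exp (-(δ₁ * (geoCK i c).dist a a'))) := by ring
      _ ≤ cV * (αW * ((geoCK i c).len a ^ 2)⁻¹ * Real.exp (-(δ₁ * (geoCK i c).dist a a'))) := mul_le_mul_of_nonneg_right hle hw
      _ = cV * αW * ((geoCK i c).len a ^ 2)⁻¹ * Real.exp (-(δ₁ * (geoCK i c).dist a a')) := by ring
  have hV1' : ∀ μ, HasMajorant (g := toB6 (geoCK i c) Rr H) (blkBK i c)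
      (conj b ((V1Y i (locCfgY i c (kGeo i).eta A) μ).restrictScalars ℝ))
      (fun a a' => cV * αW * ((geoCK i c).len a)⁻¹ * Real.exp (-(δ₁ * (geoCK i c).dist a a'))) := fun μ => by
    refine hasMajorant_mono (g := toB6 (geoCK i c) Rr H) _ (hV1 μ) fun a a' => ?_
    have hl : 0 ≤ ((geoCK i c).len a)⁻¹ := inv_nonneg.2 (geoCK_len_pos i c a).le
    have hw : 0 ≤ αW * ((geoCK i c).len a)⁻¹ * Real.exp (-(δ₁ * (geoCK i c).dist a a')) := by positivity
    have hle : (M₂ * ∑ j, ‖b j‖) * (cV1 d * Real.exp (2 * δ₁)) ≤ cV := by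
      rw [hcVdef, mul_assoc (M₂ * ∑ j, ‖b j‖)]; exact mul_le_mul_of_nonneg_left (mul_le_mul_of_nonneg_right (le_max_right _ _) (Real.exp_pos _).le) hMS
    calc (M₂ * ∑ j, ‖b j‖) * (cV1 d * Real.exp (2 * δ₁) * αW * ((geoCK i c).len a)⁻¹ * Real.exp (-(δ₁ * (geoCK i c).dist a a')))
        = (M₂ * ∑ j, ‖b j‖) * (cV1 d * Real.exp (2 * δ₁)) * (αW * ((geoCK i c).len a)⁻¹ * Real.exp (-(δ₁ * (geoCK i c).dist a a'))) := by ring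
      _ ≤ cV * (αW * ((geoCK i c).len a)⁻¹ * Real.exp (-(δ₁ * (geoCK i c).dist a a'))) := mul_le_mul_of_nonneg_right hle hw
      _ = cV * αW * ((geoCK i c).len a)⁻¹ * Real.exp (-(δ₁ * (geoCK i c).dist a a')) := by ring
  -- SLOT `P⁰`, `P¹_μ`: G-F5c″ split + G-F5b at bridge II's windows, rate `δ₁`
  have hProj := projPieceK_eq_firstOrder_add_projWord b i c (parSymY i) (locCfgY i c (kGeo i).eta A)
  have hW1 := hW1_locCfgY i c hC hξ hΛ hξS hQ hA hdA hΛξ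
  have hW2 := hW2_locCfgY i c hC hξ hΛ hξS hQ hA hdA hΛξ
  have hP0 := hasMajorant_P0Y i c b hU hM₂ hrepr hαW0 hαW1 hW1 hW2 hδ₁.le Rr H
  have hP1 := fun μ => hasMajorant_P1Y i c b hU hM₂ hrepr hαW0 hW1 hδ₁.le Rr H μ
  have hP0' : HasMajorant (g := toB6 (geoCK i c) Rr H) (blkBK i c)
      (conj b ((P0Y i (locCfgY i c (kGeo i).eta A)).restrictScalars ℝ))
      (fun a a' => cP * αW * ((geoCK i c).len a ^ 2)⁻¹ * Real.exp (-(δ₁ * (geoCK i c).dist a a'))) := by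
    refine hasMajorant_mono (g := toB6 (geoCK i c) Rr H) _ hP0 fun a a' => ?_
    have hw : 0 ≤ αW * ((geoCK i c).len a ^ 2)⁻¹ * Real.exp (-(δ₁ * (geoCK i c).dist a a')) := by positivity
    have hle : (M₂ * ∑ j, ‖b j‖) * (cP0 d * Real.exp (2 * δ₁)) ≤ cP := by
      rw [hcPdef, mul_assoc (M₂ * ∑ j, ‖b j‖)]; exact mul_le_mul_of_nonneg_left (mul_le_mul_of_nonneg_right (le_max_left _ _) (Real.exp_pos _).le) hMS
    calc (M₂ * ∑ j, ‖b j‖) * (cP0 d * Real.exp (2 * δ₁) * αW * ((geoCK i c).len a ^ 2)⁻¹ * Real.exp (-(δ₁ * (geoCK i c).dist a a')))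
        = (M₂ * ∑ j, ‖b j‖) * (cP0 d * Real.exp (2 * δ₁)) * (αW * ((geoCK i c).len a ^ 2)⁻¹ * Real.exp (-(δ₁ * (geoCK i c).dist a a'))) := by ring
      _ ≤ cP * (αW * ((geoCK i c).len a ^ 2)⁻¹ * Real.exp (-(δ₁ * (geoCK i c).dist a a'))) := mul_le_mul_of_nonneg_right hle hw
      _ = cP * αW * ((geoCK i c).len a ^ 2)⁻¹ * Real.exp (-(δ₁ * (geoCK i c).dist a a')) := by ring
  have hP1' : ∀ μ, HasMajorant (g := toB6 (geoCK i c) Rr H) (blkBK i c)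
      (conj b ((P1Y i (locCfgY i c (kGeo i).eta A) μ).restrictScalars ℝ))
      (fun a a' => cP * αW * ((geoCK i c).len a)⁻¹ * Real.exp (-(δ₁ * (geoCK i c).dist a a'))) := fun μ => by
    refine hasMajorant_mono (g := toB6 (geoCK i c) Rr H) _ (hP1 μ) fun a a' => ?_
    have hl : 0 ≤ ((geoCK i c).len a)⁻¹ := inv_nonneg.2 (geoCK_len_pos i c a).le
    have hw : 0 ≤ αW * ((geoCK i c).len a)⁻¹ * Real.exp (-(δ₁ * (geoCK i c).dist a a')) := by positivity
    have hle : (M₂ * ∑ j, ‖b j‖) * (cP1 d * Real.exp (2 * δ₁)) ≤ cP := by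
      rw [hcPdef, mul_assoc (M₂ * ∑ j, ‖b j‖)]; exact mul_le_mul_of_nonneg_left (mul_le_mul_of_nonneg_right (le_max_right _ _) (Real.exp_pos _).le) hMS
    calc (M₂ * ∑ j, ‖b j‖) * (cP1 d * Real.exp (2 * δ₁) * αW * ((geoCK i c).len a)⁻¹ * Real.exp (-(δ₁ * (geoCK i c).dist a a')))
        = (M₂ * ∑ j, ‖b j‖) * (cP1 d * Real.exp (2 * δ₁)) * (αW * ((geoCK i c).len a)⁻¹ * Real.exp (-(δ₁ * (geoCK i c).dist a a'))) := by ring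
      _ ≤ cP * (αW * ((geoCK i c).len a)⁻¹ * Real.exp (-(δ₁ * (geoCK i c).dist a a'))) := mul_le_mul_of_nonneg_right hle hw
      _ = cP * αW * ((geoCK i c).len a)⁻¹ * Real.exp (-(δ₁ * (geoCK i c).dist a a')) := by ring
  -- SLOT `P₁` word: G-F5c′ at the datum (the nine readings as in G-F7 ∕ p21's `cinv_cube_at_locCfg`) + G-F5c″, rate weakened `δ_P → δ₁`
  have hlenS : ∀ z : SiteY i, (geoCK i c).len (blkCubeY i c z) = LatticeNorms.scaleLen ((ℓ : ℝ) + 1) η (levCubeY i c z) := fun z => by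
    rw [(geoCK_len_blkCubeY i c z).1]; rfl
  have hlen : ∀ z : SiteY i, 0 < (geoCK i c).len (blkCubeY i c z) := fun z => by
    rw [hlenS]; exact (scaleLen_levCubeY_bounds i c hL1 hη hΛξ z).1
  have hlenΛ : ∀ z : SiteY i, (geoCK i c).len (blkCubeY i c z) ≤ Λ * ξ := fun z => by
    rw [hlenS]; exact (scaleLen_levCubeY_bounds i c hL1 hη hΛξ z).2
  obtain ⟨r1, r2, r3, r4, r5⟩ := readings337_locFld i c hC hη hξ hΛ hξS hQ hA hdA (fun z => (geoCK i c).len (blkCubeY i c z)) hlen hlenΛ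
  have hG1 : ∀ u : 𝔸ˣ, u ∈ (⊥ : Subgroup 𝔸ˣ) → ‖(u : 𝔸)‖ ≤ 1 := fun u hu => by
    rw [Subgroup.mem_bot] at hu; rw [hu, Units.val_one]; exact h1A
  have hU1 : ∀ (μ : Fin (d + 1)) (x : Site (PV d ℓ i.m i.K hd hL) 0), ((fun _ _ => (1 : 𝔸ˣ)) : CfgY 𝔸 i) μ x ∈ (⊥ : Subgroup 𝔸ˣ) :=
    fun _ _ => Subgroup.one_mem _
  have hown := ownLevel_of_blockwise i c hη (cutFldY i (chiTY i c) A) (α₁ := s) (fun k x => by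
    have h := r4 k x
    rw [(geoCK_len_blkCubeY i c x).1, levCubeY_eq] at h
    push_cast
    exact h)
  have hkF : ∀ (y : BlkCubeY i c) (x : SiteY i), blkCubeY i c x = y →
      ‖kFCubeY i c (parSymY i) (fun _ _ => 1) (locCfgY i c η A) y x‖ ≤ Cq d * s * wK i c y :=
    fun y x hx => norm_kFCubeY_parSymY_le i c ⊥ hG1 hU1 hη.le (cutFldY i (chiTY i c) A) y hs0 hs4 (hown y) x hx
  have hsF : ∀ x : SiteY i, ‖sFCubeY i c (parSymY i) (fun _ _ => 1) (locCfgY i c η A) x‖ ≤ Cq d * s :=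
    fun x => norm_sFCubeY_parSymY_le i c ⊥ hG1 hU1 hη.le (cutFldY i (chiTY i c) A) x hs0 hs4 (hown (blkCubeY i c x))
  have hF : ∀ (s' : BlkCubeY i c) (lam : SiteY i → 𝔸),
      ‖(QpCubeY i c (parSymY i) (locCfgY i c η A) lam - QpCubeY i c (parSymY i) (fun _ _ => 1) lam) s'‖ ≤ Cq d * s * ∑ z, |qpKc i c s' z| * ‖lam z‖ :=
    fun s' lam => norm_QpCubeY_prod_sub_apply_le i c ⊥ hG1 hU1 hη.le (cutFldY i (chiTY i c) A) s' hs0 hs4 (hown s') lam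
  have hFs : ∀ (z : SiteY i) (nu : BlkCubeY i c → 𝔸),
      ‖(QpsCubeY i c (parSymY i) (locCfgY i c η A) nu - QpsCubeY i c (parSymY i) (fun _ _ => 1) nu) z‖ ≤ Cq d * s * ∑ s', |qpsKc i c z s'| * ‖nu s'‖ :=
    fun z nu => norm_QpsCubeY_prod_sub_apply_le i c ⊥ hG1 hU1 hη.le (cutFldY i (chiTY i c) A) z hs0 hs4 (hown (blkCubeY i c z)) nu
  have hPO := hP i c Rr H (parSymY i) hparS hMP hNP hTP s hs0 hsP A hkF hsF
    (fun ν k x => by rw [geoCK_eta]; exact r1 ν k x) (fun μ ν x => by rw [geoCK_eta]; exact r2 μ ν x)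
    (fun μ x => by rw [geoCK_eta]; exact r3 μ x) r4 r5 hF hFs
  have hPP0 := hasMajorant_projWord_of_POne b i c (parSymY i) Rr H (locCfgY i c (kGeo i).eta A) hPO
  have hPP : HasMajorant (g := toB6 (geoCK i c) Rr H) (blkBK i c)
      (conj b ((Node00.gradY i (locCfgY i c (kGeo i).eta A) ∘ₗ
          (GpCubeY i c (parSymY i) (locCfgY i c (kGeo i).eta A) ∘ₗ QpsCubeY i c (parSymY i) (locCfgY i c (kGeo i).eta A) ∘ₗ
            XinvCubeY i c (parSymY i) (locCfgY i c (kGeo i).eta A) ∘ₗ QpCubeY i c (parSymY i) (locCfgY i c (kGeo i).eta A) ∘ₗ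
            GpCubeY i c (parSymY i) (locCfgY i c (kGeo i).eta A)) ∘ₗ Node00.divY i (locCfgY i c (kGeo i).eta A) -
        Node00.gradY i (fun _ _ => 1) ∘ₗ (GpCubeY i c (parSymY i) (fun _ _ => 1) ∘ₗ QpsCubeY i c (parSymY i) (fun _ _ => 1) ∘ₗ
          XinvCubeY i c (parSymY i) (fun _ _ => 1) ∘ₗ QpCubeY i c (parSymY i) (fun _ _ => 1) ∘ₗ GpCubeY i c (parSymY i) (fun _ _ => 1)) ∘ₗ
          Node00.divY i (fun _ _ => 1)).restrictScalars ℝ))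
      (fun a a' => K * αW * ((geoCK i c).len a ^ 2)⁻¹ * Real.exp (-(δ₁ * (geoCK i c).dist a a'))) := by
    refine hasMajorant_mono (g := toB6 (geoCK i c) Rr H) _ hPP0 fun a a' => ?_
    have hl : 0 ≤ ((geoCK i c).len a ^ 2)⁻¹ := by positivity
    calc K * s * ((geoCK i c).len a ^ 2)⁻¹ * Real.exp (-(δP * (geoCK i c).dist a a'))
        = (K * s) * ((geoCK i c).len a ^ 2)⁻¹ * Real.exp (-(δP * (geoCK i c).dist a a')) := by ring
      _ ≤ (K * αW) * ((geoCK i c).len a ^ 2)⁻¹ * Real.exp (-(δ₁ * (geoCK i c).dist a a')) :=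
          kernel_const_mono hdnn (fun a => ((geoCK i c).len a ^ 2)⁻¹) (fun a => by positivity) (mul_le_mul_of_nonneg_left (self_le_alphaW hs0) hK)
            (mul_nonneg hK hαW0) (hδ₁δ.trans hδP') a a'
      _ = K * αW * ((geoCK i c).len a ^ 2)⁻¹ * Real.exp (-(δ₁ * (geoCK i c).dist a a')) := by ring
  -- SLOT averaging piece: bridge II, rate `δ₁`
  have hAv0 := hasMajorant_avgPieceK_locCfgY b i c hC hξ hΛ hξS hΛξ hQ hA hdA hAu hM₂ hrepr hb₀ hb₁ hδ₁.le Rr H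
  have hAv : HasMajorant (g := toB6 (geoCK i c) Rr H) (blkBK i c) (avgPieceK b i c (locCfgY i c (kGeo i).eta A))
      (fun a a' => κ₂ * αW * ((geoCK i c).len a ^ 2)⁻¹ * Real.exp (-(δ₁ * (geoCK i c).dist a a'))) := by
    refine hasMajorant_mono (g := toB6 (geoCK i c) Rr H) _ hAv0 fun a a' => ?_
    have hw : 0 ≤ ((geoCK i c).len a ^ 2)⁻¹ * Real.exp (-(δ₁ * (geoCK i c).dist a a')) := by positivity
    have hk := kappaAv_le_of_le_one d ℓ (δ := δ₁) hb₁0 hαW0 hαW1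
    calc (M₂ * ∑ j, ‖b j‖) * (kappaAv d ℓ b₁ αW δ₁ * ((geoCK i c).len a ^ 2)⁻¹ * Real.exp (-(δ₁ * (geoCK i c).dist a a')))
        = (M₂ * ∑ j, ‖b j‖) * kappaAv d ℓ b₁ αW δ₁ * (((geoCK i c).len a ^ 2)⁻¹ * Real.exp (-(δ₁ * (geoCK i c).dist a a'))) := by ring
      _ ≤ (M₂ * ∑ j, ‖b j‖) * (αW * (8 * ((d : ℝ) + 2) * (1 + ((d : ℝ) + 2)) * b₁ * (((ℓ + 1 : ℕ) : ℝ) ^ (d + 1)) * Real.exp (δ₁ * (2 * (ℓ : ℝ) + 6)))) *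
            (((geoCK i c).len a ^ 2)⁻¹ * Real.exp (-(δ₁ * (geoCK i c).dist a a'))) :=
          mul_le_mul_of_nonneg_right (mul_le_mul_of_nonneg_left hk hMS) hw
      _ = κ₂ * αW * ((geoCK i c).len a ^ 2)⁻¹ * Real.exp (-(δ₁ * (geoCK i c).dist a a')) := by rw [hκ₂def]; ring
  -- SLOT commutators: G-F8a at the rate `δ₁`
  have hCV := fun μ => hasMajorant_commV1Y_locCfgY i b c hC hξ hΛ hξS hΛξ hQ hA hdA hAu hM₂ hrepr hαW1 hδ₁.le Rr H μ μ
  have hCP := fun μ => hasMajorant_commP1Y_locCfgY i b c hC hξ hΛ hξS hΛξ hQ hA hdA hAu hM₂ hrepr hδ₁.le Rr H μ μ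
  have hCk : ∀ μ, HasMajorant (g := toB6 (geoCK i c) Rr H) (blkBK i c)
      ((conj b ((V1Y i (locCfgY i c (kGeo i).eta A) μ).restrictScalars ℝ) + conj b ((P1Y i (locCfgY i c (kGeo i).eta A) μ).restrictScalars ℝ)) * DK b i μ -
        DK b i μ * (conj b ((V1Y i (locCfgY i c (kGeo i).eta A) μ).restrictScalars ℝ) + conj b ((P1Y i (locCfgY i c (kGeo i).eta A) μ).restrictScalars ℝ)))
      (fun a a' => cKc * αW * ((geoCK i c).len a ^ 2)⁻¹ * Real.exp (-(δ₁ * (geoCK i c).dist a a'))) := fun μ => by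
    rw [add_mul_sub_mul_add]
    refine hasMajorant_mono (g := toB6 (geoCK i c) Rr H) _ (hasMajorant_add (g := toB6 (geoCK i c) Rr H) _ (hCV μ) (hCP μ)) fun a a' => le_of_eq ?_
    rw [hcKcdef]; ring
  -- the zeroth-order part `Z` and the first-order coefficients `W_μ`
  have hZ : HasMajorant (g := toB6 (geoCK i c) Rr H) (blkBK i c)
      (conj b ((V0Y i (locCfgY i c (kGeo i).eta A)).restrictScalars ℝ) + conj b ((P0Y i (locCfgY i c (kGeo i).eta A)).restrictScalars ℝ) +
        conj b ((Node00.gradY i (locCfgY i c (kGeo i).eta A) ∘ₗ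
          (GpCubeY i c (parSymY i) (locCfgY i c (kGeo i).eta A) ∘ₗ QpsCubeY i c (parSymY i) (locCfgY i c (kGeo i).eta A) ∘ₗ
            XinvCubeY i c (parSymY i) (locCfgY i c (kGeo i).eta A) ∘ₗ QpCubeY i c (parSymY i) (locCfgY i c (kGeo i).eta A) ∘ₗ
            GpCubeY i c (parSymY i) (locCfgY i c (kGeo i).eta A)) ∘ₗ Node00.divY i (locCfgY i c (kGeo i).eta A) -
        Node00.gradY i (fun _ _ => 1) ∘ₗ (GpCubeY i c (parSymY i) (fun _ _ => 1) ∘ₗ QpsCubeY i c (parSymY i) (fun _ _ => 1) ∘ₗ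
          XinvCubeY i c (parSymY i) (fun _ _ => 1) ∘ₗ QpCubeY i c (parSymY i) (fun _ _ => 1) ∘ₗ GpCubeY i c (parSymY i) (fun _ _ => 1)) ∘ₗ
          Node00.divY i (fun _ _ => 1)).restrictScalars ℝ) +
        avgPieceK b i c (locCfgY i c (kGeo i).eta A))
      (fun a a' => cZ * αW * ((geoCK i c).len a ^ 2)⁻¹ * Real.exp (-(δ₁ * (geoCK i c).dist a a'))) := by
    refine hasMajorant_mono (g := toB6 (geoCK i c) Rr H) _
      (hasMajorant_add (g := toB6 (geoCK i c) Rr H) _ (hasMajorant_add (g := toB6 (geoCK i c) Rr H) _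
        (hasMajorant_add (g := toB6 (geoCK i c) Rr H) _ hV0' hP0') hPP) hAv) fun a a' => le_of_eq ?_
    rw [hcZdef]; ring
  have hWk : ∀ μ, HasMajorant (g := toB6 (geoCK i c) Rr H) (blkBK i c)
      (conj b ((V1Y i (locCfgY i c (kGeo i).eta A) μ).restrictScalars ℝ) + conj b ((P1Y i (locCfgY i c (kGeo i).eta A) μ).restrictScalars ℝ))
      (fun a a' => (cV + cP) * αW * ((geoCK i c).len a)⁻¹ * Real.exp (-(δ₁ * (geoCK i c).dist a a'))) := fun μ =>
    hasMajorant_mono (g := toB6 (geoCK i c) Rr H) _ (hasMajorant_add (g := toB6 (geoCK i c) Rr H) _ (hV1' μ) (hP1' μ)) fun a a' => le_of_eq (by ring)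
  -- §1 at the cube: `G_□(1)·V_□ ≺ κ_R·α_W·e^{−δ₂d}`, `V_□ = Z + Σ_μ W_μ∇_μ` re-associated from `VK_eq_pieces`
  have hGV := hasMajorant_GV_of_gradForm_comm_dirs (R := Rr) (H := H) (blkBK i c) dB δ₂ δ₁ (9 / 5000) (9 / 5000) δ₂ Λ4 B₀ cZ (cV + cP) cKc αW
    hB₀ hcZ (add_nonneg hcV hcP) hcKc hαW0 hΛ4 hδ₂.le (by norm_num) (by norm_num) hδ₂.le (by rw [hδ₁def, hδ₂def]; linarith only [hδ.le]) hdnn htri (geoCK_len_pos i c)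
    h261' hST3 hST4 hZ hWk hCk hGδ₁ hGDδ₁
  have eVK : VK b i c (parSymY i) (parBY i) (locCfgY i c (kGeo i).eta A) =
      (conj b ((V0Y i (locCfgY i c (kGeo i).eta A)).restrictScalars ℝ) + conj b ((P0Y i (locCfgY i c (kGeo i).eta A)).restrictScalars ℝ) +
        conj b ((Node00.gradY i (locCfgY i c (kGeo i).eta A) ∘ₗ
          (GpCubeY i c (parSymY i) (locCfgY i c (kGeo i).eta A) ∘ₗ QpsCubeY i c (parSymY i) (locCfgY i c (kGeo i).eta A) ∘ₗ
            XinvCubeY i c (parSymY i) (locCfgY i c (kGeo i).eta A) ∘ₗ QpCubeY i c (parSymY i) (locCfgY i c (kGeo i).eta A) ∘ₗ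
            GpCubeY i c (parSymY i) (locCfgY i c (kGeo i).eta A)) ∘ₗ Node00.divY i (locCfgY i c (kGeo i).eta A) -
        Node00.gradY i (fun _ _ => 1) ∘ₗ (GpCubeY i c (parSymY i) (fun _ _ => 1) ∘ₗ QpsCubeY i c (parSymY i) (fun _ _ => 1) ∘ₗ
          XinvCubeY i c (parSymY i) (fun _ _ => 1) ∘ₗ QpCubeY i c (parSymY i) (fun _ _ => 1) ∘ₗ GpCubeY i c (parSymY i) (fun _ _ => 1)) ∘ₗ
          Node00.divY i (fun _ _ => 1)).restrictScalars ℝ) +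
        avgPieceK b i c (locCfgY i c (kGeo i).eta A)) +
      ∑ μ, (conj b ((V1Y i (locCfgY i c (kGeo i).eta A) μ).restrictScalars ℝ) + conj b ((P1Y i (locCfgY i c (kGeo i).eta A) μ).restrictScalars ℝ)) *
        DK b i μ := by
    rw [VK_eq_pieces, hLap, hProj]
    have e2 : ∑ μ, (conj b ((V1Y i (locCfgY i c (kGeo i).eta A) μ).restrictScalars ℝ) + conj b ((P1Y i (locCfgY i c (kGeo i).eta A) μ).restrictScalars ℝ)) *
        DK b i μ = ∑ μ, conj b ((V1Y i (locCfgY i c (kGeo i).eta A) μ).restrictScalars ℝ) * DK b i μ +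
          ∑ μ, conj b ((P1Y i (locCfgY i c (kGeo i).eta A) μ).restrictScalars ℝ) * DK b i μ := by
      rw [← Finset.sum_add_distrib]
      exact Finset.sum_congr rfl fun μ _ => add_mul _ _ _
    rw [e2]
    abel
  rw [eVK]
  refine hasMajorant_mono (g := toB6 (geoCK i c) Rr H) _ hGV fun a a' => ?_
  have hw : 0 ≤ Real.exp (-(δ₂ * (geoCK i c).dist a a')) := (Real.exp_pos _).le
  have hcoef : B₀ * Λ4 * B6.c1 dB δ₂ (9 / 5000) * ((Fintype.card (Fin (d + 1)) : ℝ) * (cV + cP) + (cZ + (Fintype.card (Fin (d + 1)) : ℝ) * cKc)) = κR := by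
    rw [hκRdef]
    simp only [Fintype.card_fin, Nat.cast_add, Nat.cast_one]
    ring
  rw [hcoef]
  calc κR * αW * Real.exp (-(δ₂ * (geoCK i c).dist a a')) ≤ κR * (60 * s) * Real.exp (-(δ₂ * (geoCK i c).dist a a')) :=
        mul_le_mul_of_nonneg_right (mul_le_mul_of_nonneg_left hαW60 hκR) hw
    _ = 60 * κR * s * Real.exp (-(δ₂ * (geoCK i c).dist a a')) := by ring

end Main

end Literature.MathematicalPhysics.QuantumFieldTheory.Balaban1983to89.B9Cor36GVKDivForm

end
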